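import Summits.CriticalPhenomena.PercolationContinuityZ3.Theorems.PercNearOneGluingNoHeavyLowerTailSunflowerCoverCounterexample
import HarnessLib
import HarnessLib.Audit

/-!
# `NoHeavyLowerTail` (crux stmt-CriticalPhenomena-4575), abstract sunflower cubic: THE CONJECTURE "SAFE ⟹ GRADEDLY SAFE" AS A TYPED TARGET

Support file (seat `prim-ineq-prove-1` gen 37; `--supports stmt-CriticalPhenomena-4575`).  No `sorry`.  The `@[conjecture]` definition is an
obligation of this programme (census-true, unproved), never a fact — it is used only as an explicit hypothesis.
Memo: run/shared/lean/prim/prim-ineq-prove-1/FINDING-TROPICAL-prove1-g37.md §3, §5.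

The stronger conjecture `CoverOfSafe` (SAFE ⟹ COVER) of `…SunflowerCoverConjecture` is FALSE (`not_coverOfSafe`,
`…SunflowerCoverCounterexample`).  What the calculus actually needs for the disjunction rule is graded safety (`GSafe`), which is
strictly weaker than COVER and survives every test: the fan core and the pentagon core (the COVER counterexamples) are numerically
gradedly safe, all 36 tropically-safe five-point core classes are (1,728 optimiser runs, memo §6), and at the exponent level SAFE ⟹ GS is
a THEOREM in every valuation regime `p_e = ε^{a_e}` (memo §3: the grouping lemma for fractional packings).  Hence the typed target:
* `GSafeOfSafe` — every safe up-set determined by a block, of positive probability, is gradedly safe on that block;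
* `safe_union_of_gSafeOfSafe` — under it, safety is closed under disjunction on disjoint blocks (with `safe_inter`, the safe cores would
  form a class closed under the read-once operations with arbitrary safe leaves).
-/

noncomputable section

namespace Summit.CriticalPhenomena.PercolationContinuityZ3.Theorems.SunflowerPartition

namespace SafeCalc

open MeasureTheory Finset
open Literature.Probability.LatticeModels Literature.Probability.Percolation

/-- **CONJECTURE (SAFE ⟹ GRADEDLY SAFE)** (memo §5(1)): for every product measure, every safe up-set `A` determined by a block `a`
with `μ A > 0` is gradedly safe on `a`.  True at the exponent level in every valuation regime (memo §3); census-true; the stronger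
"SAFE ⟹ COVER" is false (`not_coverOfSafe`). [this work] -/
@[conjecture] def GSafeOfSafe : Prop :=
  ∀ (ι : Type) [Fintype ι] [DecidableEq ι] (p : ι → unitInterval) (a : Finset ι) (A : Set (Set ι)),
    DeterminedBy A (↑a : Set ι) → IsUpperSet A → 0 < (prodBernoulli p).real A → Safe p A → GSafe p a A

variable {ι : Type} [Fintype ι] [DecidableEq ι] (p : ι → unitInterval)

/-- Under `GSafeOfSafe`, safety is closed under DISJUNCTION on disjoint blocks (first operand determined by the block `a` with positive
probability, second operand determined by the complement with positive probability). [this work] -/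
theorem safe_union_of_gSafeOfSafe (hconj : GSafeOfSafe) (a : Finset ι) {A₁ A₂ : Set (Set ι)}
    (hd₁ : DeterminedBy A₁ (↑a : Set ι)) (hd₂ : DeterminedBy A₂ (↑a : Set ι)ᶜ) (hu₁ : IsUpperSet A₁) (hu₂ : IsUpperSet A₂)
    (hA₁ : 0 < (prodBernoulli p).real A₁) (hA₂ : 0 < (prodBernoulli p).real A₂) (h₁ : Safe p A₁) (h₂ : Safe p A₂) :
    Safe p (A₁ ∪ A₂) :=
  safe_union_of_gsafe p a hd₁ hd₂ hu₁ hu₂ hA₂ (hconj ι p a A₁ hd₁ hu₁ hA₁ h₁) h₂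

/-- The fan core of `…SunflowerCoverCounterexample` is a test case: under `GSafeOfSafe` it is gradedly safe at `p = 1/32` although it
does not have the cover property (`Fan.not_cover`) — so no proof of the conjecture can factor through `Cover`. [this work] -/
theorem Fan.gsafe_core_of_gSafeOfSafe (hconj : GSafeOfSafe) : GSafe Fan.p32 univ Fan.core :=
  hconj (Fin 4) Fan.p32 univ Fan.core Fan.determinedBy_core Fan.isUpperSet_core Fan.real_core_pos Fan.safe_core

end SafeCalc

end Summit.CriticalPhenomena.PercolationContinuityZ3.Theorems.SunflowerPartition
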